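import Literature.AlgebraicGeometry.HodgeTheory.PicardLefschetzSymmetricA3OfUniform
import Literature.AlgebraicGeometry.HodgeTheory.PicardLefschetzOneNodeMonomialShapes
import Literature.AlgebraicGeometry.HodgeTheory.PicardLefschetzSymmetricA3OfKeyed
import HarnessLib

/-!
# The Picard–Lefschetz pair data of the symmetric `A₃` unfolding from the exchanged-pair binder ALONE (one-node half discharged), two coefficients

Family `hodge`, layer `Literature/AlgebraicGeometry/HodgeTheory`; proof file (theorems only).  Written by the prover seat
`hodge-nonav-19716-p2` (g10, cell `hodge-nonav`) for crux K1-B `VeryGeneralSignCommutatorsInHg` (stmt-HodgeConjecture-19716), P3 g34 DECISION (2)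
2026-08-29T00:07:12Z (v24 = {hPL₂exch, hCDK, hN}).  VERBATIM twin of `PicardLefschetzSymmetricA3OfKeyed.symmetricA3PicardLefschetzPair₂_of_keyed` in which
the one-node binder `picardLefschetz_oneNode` is REPLACED BY A THEOREM — prover-Bx's `NodalPencil.picardLefschetz_oneNode_monomial` (p680592), through
`exists_isPicardLefschetzData_of_radius_monomial` — at the price of the hypothesis that the even unfolding direction `g₀` is a monomial `a·xᵢ^d` (true
at the consumption site, `g₀ := x_j^d`); the pair half still comes from `picardLefschetz_exchangedPair`; helpers `mem_diagonalStabilizer_add_smul`,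
`exists_smul_swap` reused from the parent file.

* `symmetricA3PicardLefschetzPair₂_of_exchangedPair` — **(P1) ∧ (P2), two coefficients ⟸ hPL₂exch alone** (odd `n`, monomial `g₀`).

CONDITIONAL plumbing; nothing here proves HC; rung F-H1 is not moved.

References: [VoisinHodgeII2003] Voisin, *Hodge Theory and Complex Algebraic Geometry II*, §2.3.1, §3.1.2, §3.2.1 Thm. 3.16,
§3.2.2; [ArnoldGuseinzadeVarchenko2012] AGZV II, Part I §1.3, §5.2 (pp. 129–133).
-/

noncomputable section

open CategoryTheory AlgebraicGeometry MvPolynomial Filter Topology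
open Literature.AlgebraicTopology.SingularHomology
open Literature.AlgebraicGeometry.Motives Literature.AlgebraicGeometry.Motives.UniversalHypersurface

namespace Literature.AlgebraicGeometry.HodgeTheory

section HodgeTheory

variable {n d : ℕ} {f₁ g₀ g₂ : MvPolynomial (Fin (n + 2)) ℂ} {j k : Fin (n + 2)} {a : Fin (n + 2) → ℂˣ}
  {εa εb : ℝ} {ψ : ℂ → ℂ}

/-! ### §1 (P1) ∧ (P2) with two coefficients from the exchanged-pair binder -/

/-- `(r * E) • g = (((1 : ℝ) : ℂ) * E) • (r • g)`: the complex-radius circle as the radius-`1` circle of the rescaled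
co-pencil form. [cite: VoisinHodgeII2003, §2.3.1] -/
private theorem smul_rescale (r E : ℂ) (g : MvPolynomial (Fin (n + 2)) ℂ) :
    (r * E) • g = (((1 : ℝ) : ℂ) * E) • (r • g) := by
  rw [smul_smul, Complex.ofReal_one, one_mul, mul_comm]

/-- **(P1) ∧ (P2) with TWO coefficients ⟸ the exchanged-pair binder alone** (odd fibre dimension; `g₀` a monomial `a·xᵢ^d`, as at the
consumption site where `g₀ := x_j^d`; the one-node circle is served by the THEOREM `NodalPencil.picardLefschetz_oneNode_monomial`).  For a symmetric `A₃` datum, a bifurcation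
datum `(εa, εb, ψ)`, and the radius of `IsSymmetricA3Bifurcation.exists_radius_eval_g₀_ne`: granted `picardLefschetz_exchangedPair` only, the two circles of hB2 at the midpoint base point carry Picard–Lefschetz data `![e₂]` (one node `e_j`
of `f₁ + a'g₂`, pencil direction `(ψ a'/2)·g₀`, radius `1`) with SOME coefficient `c₁`, and `![e₁, e₃]` (the two nodes `q₀`, `q₁ ∝ a • q₀`
of `f₁ + a'g₂ + ψ(a')g₀`, EXCHANGED by the datum's involution `a`, direction `−(ψ a'/2)·g₀`, radius `1`) with SOME coefficient `c₂` — the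
two-coefficient form of `SymmetricA3PicardLefschetzPair` (Voisin II Thm. 3.16 at the two members; AGZV II §5.2 for the `B₂` unfolding; no common
flat coefficient).  Proof = g9's `symmetricA3PicardLefschetzPair_of_uniform` with the data supplied by the «any radius» shapes of
`PicardLefschetzNodalFormsKeyedShapes`; the symmetry hypotheses of the pair binder are read off the datum (`a` has entries `±1`, stabilises
`f₁, g₀, g₂`, and `a • q₀ ∝ q₁`).
[cite: VoisinHodgeII2003, §3.2.1 Thm. 3.16, §3.2.2 and §2.3.1] [cite: ArnoldGuseinzadeVarchenko2012, Part I §5.2] -/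
theorem symmetricA3PicardLefschetzPair₂_of_exchangedPair (H₂ : picardLefschetz_exchangedPair) (hodd : Odd n)
    (hg₀X : ∃ (i : Fin (n + 2)) (a : ℂ), g₀ = a • X i ^ d) (hf₁ : f₁.IsHomogeneous d) (hg₀ : g₀.IsHomogeneous d) (hg₂ : g₂.IsHomogeneous d)
    (hD : IsSymmetricA3Datum f₁ g₀ g₂ j k a) (hB : IsSymmetricA3Bifurcation f₁ g₀ g₂ j a εa εb ψ) :
    ∃ εa' : ℝ, 0 < εa' ∧ εa' ≤ εa ∧
      ∀ (hn : 1 ≤ n) (hd : 1 ≤ d) (hU : IsCohomologicallyLocallyTrivialOn (family ℂ n d) Set.univ)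
        (a' : ℂ), ‖a'‖ < εa' → a' ≠ 0 →
        ∀ (t₀ : ComplexPoints (base ℂ n d)),
          pointForm ℂ n d t₀ = f₁ + a' • g₂ + (ψ a' / 2) • g₀ →
          ∀ (γ₁ γ₂ : Path t₀ t₀),
            (∀ θ : unitInterval, pointForm ℂ n d (γ₁ θ) =
              f₁ + a' • g₂ + (ψ a' / 2 * Complex.exp (2 * Real.pi * Complex.I * ((θ : ℝ) : ℂ))) • g₀) →
            (∀ θ : unitInterval, pointForm ℂ n d (γ₂ θ) =
              f₁ + a' • g₂ +
                (ψ a' - ψ a' / 2 * Complex.exp (2 * Real.pi * Complex.I * ((θ : ℝ) : ℂ))) • g₀) →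
            ∃ (c₁ c₂ : ℚ) (e₁ e₂ e₃ : bettiCohomology (fiberOver (family ℂ n d) t₀) n),
              IsPicardLefschetzData n d 1 hn hd hU γ₁ ![e₂] c₁ ∧
              IsPicardLefschetzData n d 2 hn hd hU γ₂ ![e₁, e₃] c₂ := by
  obtain ⟨εa', hεa', hle, hgood⟩ := hB.exists_radius_eval_g₀_ne hf₁ hg₀ hg₂ hD
  refine ⟨εa', hεa', hle, fun hn hd hU a' ha ha0 t₀ ht₀ γ₁ γ₂ hγ₁ hγ₂ => ?_⟩
  have haεa : ‖a'‖ < εa := lt_of_lt_of_le ha hle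
  -- the bifurcation clauses at `a'`
  have hψne : ψ a' ≠ 0 := hB.2.2.2.2.1 a' haεa ha0
  have hψb : 2 * ‖ψ a'‖ < εb := hB.2.2.2.2.2.1 a' haεa
  have hψpos : 0 < ‖ψ a'‖ := norm_pos_iff.2 hψne
  obtain ⟨hnod₁, q, hnod₂, hq⟩ := hB.2.2.2.2.2.2.2 a' haεa ha0
  -- the two pencils: `F₁ + c'G₁` with `F₁ = f₁ + a'g₂`, `G₁ = (ψ/2)g₀`; `F₂ + c'G₂` with `F₂ = F₁ + ψ g₀`, `G₂ = -(ψ/2)g₀`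
  have hF₁h : (f₁ + a' • g₂).IsHomogeneous d := isHomogeneous_add_smul hf₁ hg₂ a'
  have hF₂h : (f₁ + a' • g₂ + ψ a' • g₀).IsHomogeneous d := isHomogeneous_add_smul hF₁h hg₀ _
  have hG₁h : ((ψ a' / 2) • g₀).IsHomogeneous d := by
    simpa using isHomogeneous_add_smul (isHomogeneous_zero _ _ d) hg₀ (ψ a' / 2)
  have hG₂h : ((-(ψ a' / 2)) • g₀).IsHomogeneous d := by
    simpa using isHomogeneous_add_smul (isHomogeneous_zero _ _ d) hg₀ (-(ψ a' / 2))
  have hline₁ : ∀ c' : ℂ, f₁ + a' • g₂ + c' • ((ψ a' / 2) • g₀) = f₁ + a' • g₂ + (c' * (ψ a' / 2)) • g₀ :=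
    fun c' => by rw [smul_smul]
  have hline₂ : ∀ c' : ℂ, f₁ + a' • g₂ + ψ a' • g₀ + c' • ((-(ψ a' / 2)) • g₀) =
      f₁ + a' • g₂ + (ψ a' - c' * (ψ a' / 2)) • g₀ := fun c' => by
    rw [smul_smul, sub_smul, mul_neg, neg_smul]; abel
  -- nonsingularity of the punctured unit discs
  have hbnd : ∀ c' : ℂ, ‖c'‖ ≤ 1 → ‖c' * (ψ a' / 2)‖ ≤ ‖ψ a'‖ / 2 := fun c' hc1 => by
    rw [norm_mul, norm_div, Complex.norm_two]
    nlinarith [norm_nonneg (ψ a'), norm_nonneg c']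
  have hns₁ : ∀ c' : ℂ, c' ≠ 0 → ‖c'‖ ≤ 1 →
      SmoothHypersurface.IsNonsingularForm ℂ (f₁ + a' • g₂ + c' • ((ψ a' / 2) • g₀)) := by
    intro c' hc' hc1
    have hb := hbnd c' hc1
    rw [hline₁]
    refine hB.isNonsingularForm haεa (by linarith) (mul_ne_zero hc' (div_ne_zero hψne two_ne_zero)) ?_
    intro h
    rw [h] at hb
    linarith
  have hns₂ : ∀ c' : ℂ, c' ≠ 0 → ‖c'‖ ≤ 1 →
      SmoothHypersurface.IsNonsingularForm ℂ (f₁ + a' • g₂ + ψ a' • g₀ + c' • ((-(ψ a' / 2)) • g₀)) := by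
    intro c' hc' hc1
    have hb := hbnd c' hc1
    rw [hline₂]
    refine hB.isNonsingularForm haεa ?_ ?_ ?_
    · calc ‖ψ a' - c' * (ψ a' / 2)‖ ≤ ‖ψ a'‖ + ‖c' * (ψ a' / 2)‖ := norm_sub_le _ _
        _ < εb := by linarith
    · intro h
      rw [sub_eq_zero] at h
      rw [← h] at hb
      linarith
    · intro h
      have h' : c' * (ψ a' / 2) = 0 := by linear_combination -h
      exact mul_ne_zero hc' (div_ne_zero hψne two_ne_zero) h'
  -- the co-pencil forms miss the nodes
  have hG₁e : ∀ i : Fin 1, eval ((![Pi.single j (1 : ℂ)] : Fin 1 → Fin (n + 2) → ℂ) i) ((ψ a' / 2) • g₀) ≠ 0 := by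
    intro i
    fin_cases i
    simp only [smul_eval, Matrix.cons_val_fin_one]
    exact mul_ne_zero (div_ne_zero hψne two_ne_zero) hD.eval_g₀_ne
  have hG₂q : ∀ i : Fin 2, eval (q i) ((-(ψ a' / 2)) • g₀) ≠ 0 := by
    intro i
    rw [smul_eval]
    refine mul_ne_zero (neg_ne_zero.2 (div_ne_zero hψne two_ne_zero)) ?_
    exact hgood a' ha (q i) (hnod₂.1 i).ne_zero (hnod₂.1 i).eval_pderiv
  -- the base point and the circles in the radius-`1` idiom
  have ht₁ : pointForm ℂ n d t₀ = f₁ + a' • g₂ + ((1 : ℝ) : ℂ) • ((ψ a' / 2) • g₀) := by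
    rw [ht₀, Complex.ofReal_one, one_smul]
  have ht₂ : pointForm ℂ n d t₀ = f₁ + a' • g₂ + ψ a' • g₀ + ((1 : ℝ) : ℂ) • ((-(ψ a' / 2)) • g₀) := by
    rw [ht₀, hline₂]
    congr 2
    rw [Complex.ofReal_one]
    ring
  have hc₁ : IsPencilCircle n d (f₁ + a' • g₂) ((ψ a' / 2) • g₀) 1 γ₁ := fun θ => by
    rw [hγ₁ θ, ← smul_rescale]
  have hc₂ : IsPencilCircle n d (f₁ + a' • g₂ + ψ a' • g₀) ((-(ψ a' / 2)) • g₀) 1 γ₂ := fun θ => by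
    rw [hγ₂ θ, hline₂, Complex.ofReal_one, one_mul, mul_comm]
  -- the symmetry `a` of the datum: finite order (entries `±1`), stabilises the two-node pencil, exchanges its nodes
  obtain ⟨hsign, haf₁, hag₀, hag₂, -⟩ := hD.2.2.2.2.2.2.2.2.2.2.2
  have haa : a * a = 1 := by
    funext i
    ext
    rcases hsign i with h | h <;> simp [h]
  have hafin : IsOfFinOrder a := isOfFinOrder_iff_pow_eq_one.2 ⟨2, two_pos, by rw [pow_two, haa]⟩
  have hst₁ : a ∈ diagonalStabilizer (f₁ + a' • g₂ + ψ a' • g₀) :=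
    mem_diagonalStabilizer_add_smul (mem_diagonalStabilizer_add_smul haf₁ hag₂ a') hag₀ (ψ a')
  have hst₂ : a ∈ diagonalStabilizer ((-(ψ a' / 2)) • g₀) := by
    simpa using mem_diagonalStabilizer_add_smul (F := 0) (mem_diagonalStabilizer_zero a) hag₀ (-(ψ a' / 2))
  have hswap : ∃ t : ℂ, a • q 1 = t • q 0 := exists_smul_swap hsign (hnod₂.1 0).ne_zero hq
  have hG₁e' : eval (Pi.single j (1 : ℂ)) ((ψ a' / 2) • g₀) ≠ 0 := by
    have := hG₁e 0; rwa [Matrix.cons_val_fin_one] at this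
  -- the Picard–Lefschetz data, each with its own coefficient, moved to radius `1`
  obtain ⟨i₀, a₀, hg₀eq⟩ := hg₀X
  have hG₁X : ∃ (i : Fin (n + 2)) (a : ℂ), (ψ a' / 2) • g₀ = a • X i ^ d := ⟨i₀, ψ a' / 2 * a₀, by rw [hg₀eq, smul_smul]⟩
  obtain ⟨δ₁, c₁, hPL₁⟩ := exists_isPicardLefschetzData_of_radius_monomial hn hd hodd hU hF₁h hG₁h hG₁X hnod₁ hG₁e' one_pos hns₁
    ht₁ hc₁
  obtain ⟨δ₂, c₂, hPL₂⟩ := H₂.exists_isPicardLefschetzData_of_radius hn hd hodd hU hF₂h hG₂h hnod₂ hG₂q hafin hst₁ hst₂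
    hswap one_pos hns₂ ht₂ hc₂
  have e₂ : (![δ₂ 0, δ₂ 1] : Fin 2 → bettiCohomology (fiberOver (family ℂ n d) t₀) n) = δ₂ := by
    funext i; fin_cases i <;> rfl
  exact ⟨c₁, c₂, δ₂ 0, δ₁, δ₂ 1, hPL₁, e₂ ▸ hPL₂⟩

end HodgeTheory

end Literature.AlgebraicGeometry.HodgeTheory

end
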